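import Literature.Computability.QuantumComplexity.EvenSingularValueTransformation
import Mathlib.Analysis.SpecialFunctions.Trigonometric.Sinc
import Mathlib.Analysis.SpecialFunctions.Trigonometric.Deriv
import Mathlib.Analysis.SpecialFunctions.Sqrt
import Mathlib.Analysis.Calculus.Deriv.MeanValue
import Mathlib.Analysis.Normed.Algebra.MatrixExponential
import Mathlib.Analysis.SpecialFunctions.Exponential
import HarnessLib

/-!
# Hamiltonian simulation from `SQ_φ(H)`: the cos/sinc even-SVT split with explicit smoothness
# constants (CGLLTW 2022, §4.5 Problem 4.14 / Corollary 4.16), Frobenius form, matrix level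

Chia, Gilyén, Li, Lin, Tang, Wang, *Sampling-based sublinear low-rank matrix arithmetic framework
for dequantizing quantum machine learning*, J. ACM 69(5):33 (2022) = arXiv:1910.06151, §4.5
"Hamiltonian simulation" (held arXiv text p. 29 L16–19 = **Problem 4.14**: "Consider a Hermitian
matrix `H ∈ ℂ^{n×n}` satisfying `‖H‖ = t`, a unit vector `b ∈ ℂⁿ`, and error parameters
`ε, δ > 0`.  Given `SQ(H)` and `SQ(b)`, output `SQ_φ(b̂)` with probability `≥ 1 − δ` for some
`b̂ ∈ ℂⁿ` satisfying `‖b̂ − e^{iH}b‖ ≤ ε`"; p. 29 L31–33 = **Corollary 4.16**: "Suppose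
`ε < min(0.5, t³)`.  We can solve (Problem 4.14) in `Õ(t¹⁶‖H‖_F⁶ε⁻⁶log³(1/δ))` time, giving
`SQ_φ(b̂)` with `sq_φ(b̂) = Õ(t⁸‖H‖_F⁴ε⁻⁴log³(1/δ))`" — the base `t` of the two displayed powers
is macro-stripped in the held text and is read from Bakshi–Tang, arXiv:2303.01492, Remark 1.7
(arXiv PDF p. 11): "The only prior work [CGLLTW22] … obtains a running time `O(t¹⁶‖H‖_F⁶/ε⁶)`";
p. 29 L35–45 = the strategy: "We can write `f(x)` as a sum of an even function `a(x)` and an odd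
function `b(x)` … `f(H) = f_a(H†H) + f_b(H†H)H` … `e^{iH} b = cos(H) b + i·sinc(H) H b
= f_cos(H†H) b + f_sinc(H†H) H b`, where `f_cos(λ) := cos(√λ)` and `f_sinc(λ) := i·sinc(√λ)`";
p. 29 L46–55 = the smoothness display "`|f_cos'(x)| ≤ min(1/2, 1/(2√x))`,
`|\bar f_cos'(x)| ≤ min(1/24, 5/(2x^{3/2}))`, `|f_sinc'(x)| ≤ min(1/4, 1/x)`,
`|\bar f_sinc'(x)| ≤ min(1/60, 3/x²)`"; p. 29 L57–71 = proof of Corollary 4.16: "Using the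
Lipschitz bounds above with (thm:evenSing), we can find `R_cos`, `C_cos`, `R_sinc`, `C_sinc`
such that `‖R_cos† \bar f_cos(C_cos C_cos†) R_cos + I − f_cos(H†H)‖ ≤ ε`,
`‖R_sinc† \bar f_sinc(C_sinc C_sinc†) R_sinc + I − f_sinc(H†H)‖ ≤ ε/t` where, using that our
Lipschitz constants are all bounded by constants, `r_cos = Õ(‖H‖_F²t²ε⁻²log(1/δ))`,
`c_cos = Õ(‖H‖_F²t⁶ε⁻²log(1/δ))`, `r_sinc = Õ(‖H‖_F²t⁴ε⁻²log(1/δ))`,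
`c_sinc = Õ(‖H‖_F²t⁸ε⁻²log(1/δ))`").

This module types the MATRIX-LEVEL content of that proof on top of the tree's Frobenius-form main
theorem `SampleQuery.even_singular_value_transformation_sample_complexity`
(`EvenSingularValueTransformation.lean`: Lipschitz hypotheses on `[0,∞)` for `f` and `\bar f` with
`x·\bar f(x) = f(x)`, explicit thresholds `s ≥ 32φ²L²‖A‖_F⁴log(6/δ)/ε²`, `s ≥ 2φ²log(3/δ)`,
`c ≥ 128φ⁶\bar L²‖A‖_F⁸log(6/δ)/ε²`), for a REAL SYMMETRIC `H` (the host is stated over `ℝ`;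
`TODO(general form)`: complex Hermitian `H`, which needs the host over `ℂ`):

* §1 the four scalar functions of the split in the host's `f(0) = 0` form — `cosBar` = `\bar f_cos`
  (`(cos √x − 1)/x`, value `−1/2` at `x ≤ 0`), `cosSub x = x·cosBar x` (`= cos √x − 1 = f_cos − 1`
  on `[0,∞)`), `sincBar` = `\bar f_sinc` (`(sinc √x − 1)/x`, value `−1/6` at `x ≤ 0`),
  `sincSub x = x·sincBar x` (`= sinc √x − 1 = f_sinc − 1`) — and the smoothness display with
  PROVED Lipschitz constants on `[0,∞)`: `cosSub` is `1/2`-Lipschitz (`abs_cosSub_sub_le`),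
  `cosBar` is `1/24`-Lipschitz (`abs_cosBar_sub_le`), `sincSub` is `1/6`-Lipschitz
  (`abs_sincSub_sub_le`; the print's `1/4` follows) and `sincBar` is `1/120`-Lipschitz
  (`abs_sincBar_sub_le`; the print's `1/60` follows).  The constants come from the elementary
  remainder bounds `|sin a − a cos a| ≤ a³/3`, `|2 − 2cos a − a sin a| ≤ a⁴/12`,
  `|a cos a + 2a − 3 sin a| ≤ a⁵/60` (`a = √x`), each proved by integrating the previous one
  (monotonicity of `aᵏ/k! ∓ (·)`), and the mean value theorem on `[0,∞)` with the right-continuity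
  of `\bar f` at `0` (`|cos a − (1 − a²/2)| ≤ (5/96)a⁴`, `|sin a − (a − a³/6)| ≤ a⁵/100`);
* §2 reading the targets on `H`: `cosSub(HᵀH) = cos H − I` (`cfc_cosSub_gram`),
  `sincSub(HᵀH) = sinc H − I` (`cfc_sincSub_gram`) and `H · sinc H = sin H` (`mul_cfc_sinc`) —
  `cos √(λ²) = cos λ`, `sinc √(λ²) = sinc λ`, `λ·sinc λ = sin λ` on the spectrum (continuous
  functional calculus `cfc` of Mathlib; "`cos H`" is `cfc Real.cos H`, etc.);
* §3 **the two sketches** `cos_sketch` and `sinc_sketch`: the host theorem at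
  (`f`, `\bar f`, `L`, `\bar L`) = (`cosSub`, `cosBar`, `1/2`, `1/24`), resp.
  (`sincSub`, `sincBar`, `1/6`, `1/120`), i.e. under `SQ_φ(H)`, `H ≠ 0` symmetric, `δ ∈ (0,1]`,
  `ε > 0`: with `s ≥ 8φ²‖H‖_F⁴log(6/δ)/ε²`, `s ≥ 2φ²log(3/δ)`, `c ≥ (2/9)φ⁶‖H‖_F⁸log(6/δ)/ε²` the
  two-stage mass of `‖Rᵀ \bar f_cos(CCᵀ) R + I − cos H‖_F ≤ ε` exceeds `1 − δ`, and with
  `s ≥ (8/9)φ²‖H‖_F⁴log(6/δ)/ε²`, `s ≥ 2φ²log(3/δ)`, `c ≥ (2/225)φ⁶‖H‖_F⁸log(6/δ)/ε²` the two-stage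
  mass of `‖R'ᵀ \bar f_sinc(C'C'ᵀ) R' + I − sinc H‖_F ≤ ε` exceeds `1 − δ` — the printed
  `r_cos ≍ ‖H‖_F²t²`, `c_cos ≍ ‖H‖_F²t⁶`, `r_sinc ≍ ‖H‖_F²t⁴`, `c_sinc ≍ ‖H‖_F²t⁸` (`× ε⁻²log(1/δ)`)
  with constants, in the host's Frobenius currency (every operator norm `t² = ‖H‖²` of the print
  appears as `φ‖H‖_F²`, as in the host and in `EvenSVTDegreeBookkeeping.lean`); plus the
  deterministic odd-branch step `sin_error_le`: `‖M_s + I − sinc H‖_F ≤ ε'` ⇒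
  `‖H(M_s + I) − sin H‖_F ≤ ‖H‖_F ε'` (the print's "error `ε/t`, then multiply by `H`", `t ↦ ‖H‖_F`);
* §4 the complex reading `euler_assembly_error_le`: for ANY outputs `M_c`, `M_s` of the two
  sketches, `‖(M_c + I) + i·H(M_s + I) − (cos H + i sin H)‖_F ≤ ε₁ + ‖H‖_F ε₂` (complexified
  matrices, Mathlib's Frobenius norm), and the display `sinc_threshold_product_display` recording
  the printed dominant cost `r_sinc²c_sinc = ‖H‖_F⁶t¹⁶ℓ³/ε⁶` next to ours;
* §5 `exp_I_smul_map_eq`: `exp(i H_ℂ) = (cos H)_ℂ + i (sin H)_ℂ` for the complexified symmetric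
  `H` (spectral theorem + `e^{iλ} = cos λ + i sin λ`), so that §4 is a bound on the Frobenius
  distance to the target `e^{iH}` of Problem 4.14.

HONEST SCOPE.  Matrix-level Frobenius-norm statements about a classical two-stage length-square
sketch under sample-and-query access `SQ_φ(H)`, real symmetric `H`; the vector step of the printed
proof (`u ≈ Rb`, the output description `SQ_φ(b̂)` and its `sq_φ`), the running-time claims and the
union bound over the two independent sketch runs are NOT typed (the display in §4 is an arithmetic
identity recording the printed cost model, no algorithm is modelled); the low-rank variant
Corollary 4.15 is not typed.  "Dequantized" here means exactly: a classical procedure in the `SQ`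
access model with the stated polynomial thresholds.  Nothing in this file bears on `BQP` vs `BPP`;
no sampler or simulator is implemented.  All statements are theorems; no named facts; standard
axioms.  (Cell `qa-dq`, census row DQ-A12; literature typing, not a registered line.)
-/

noncomputable section

open scoped Matrix
open Finset Set

namespace Literature.Computability.QuantumComplexity

namespace SampleQuery

namespace HamiltonianSimulation

/-! ### §1 Smoothness of `f_cos`, `f_sinc` with explicit constants -/

/-- Monotonicity device: a function with `g 0 = 0` and non-negative derivative on `(0,∞)` is
non-negative on `[0,∞)`. [folklore] -/
private theorem nonneg_of_deriv_nonneg {g g' : ℝ → ℝ} (hc : Continuous g)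
    (hd : ∀ x, HasDerivAt g (g' x) x) (h0 : g 0 = 0) (hpos : ∀ x, 0 < x → 0 ≤ g' x)
    {a : ℝ} (ha : 0 ≤ a) : 0 ≤ g a := by
  have hmono : MonotoneOn g (Ici 0) := by
    refine monotoneOn_of_deriv_nonneg (convex_Ici 0) hc.continuousOn
      (fun z _ => (hd z).differentiableAt.differentiableWithinAt) ?_
    intro z hz
    rw [interior_Ici] at hz
    rw [(hd z).deriv]
    exact hpos z hz
  have := hmono (self_mem_Ici) ha ha
  rwa [h0] at this

/-- `|sin a − a cos a| ≤ a³/3` for `a ≥ 0` (the derivative of `sin a − a cos a` is `a sin a`,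
of modulus `≤ a²`). [folklore] -/
private theorem abs_sin_sub_mul_cos_le {a : ℝ} (ha : 0 ≤ a) :
    |Real.sin a - a * Real.cos a| ≤ a ^ 3 / 3 := by
  have hd : ∀ x, HasDerivAt (fun x => Real.sin x - x * Real.cos x) (x * Real.sin x) x := by
    intro x
    have h := (Real.hasDerivAt_sin x).fun_sub ((hasDerivAt_id' x).fun_mul (Real.hasDerivAt_cos x))
    exact h.congr_deriv (by ring)
  have hc : Continuous (fun x => Real.sin x - x * Real.cos x) := by fun_prop
  have hp : ∀ x, HasDerivAt (fun x : ℝ => x ^ 3 / 3) (x ^ 2) x := by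
    intro x
    exact ((hasDerivAt_pow 3 x).div_const 3).congr_deriv (by norm_num)
  rw [abs_le]
  constructor
  · -- `-(a³/3) ≤ sin a − a cos a`: `a³/3 + (sin a − a cos a)` has derivative `a² + a sin a ≥ 0`
    have h := nonneg_of_deriv_nonneg (g := fun x => x ^ 3 / 3 + (Real.sin x - x * Real.cos x))
      (g' := fun x => x ^ 2 + x * Real.sin x) (by fun_prop) (fun x => (hp x).add (hd x))
      (by simp) (fun x hx => by
        have : -|x| ≤ Real.sin x := (abs_le.1 Real.abs_sin_le_abs).1
        rw [abs_of_pos hx] at this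
        nlinarith) ha
    linarith
  · have h := nonneg_of_deriv_nonneg (g := fun x => x ^ 3 / 3 - (Real.sin x - x * Real.cos x))
      (g' := fun x => x ^ 2 - x * Real.sin x) (by fun_prop) (fun x => (hp x).sub (hd x))
      (by simp) (fun x hx => by
        have : Real.sin x ≤ x := Real.sin_le hx.le
        nlinarith) ha
    linarith

/-- `|2 − 2 cos a − a sin a| ≤ a⁴/12` for `a ≥ 0` (its derivative is `sin a − a cos a`).
[folklore] -/
private theorem abs_two_sub_le {a : ℝ} (ha : 0 ≤ a) :
    |2 - 2 * Real.cos a - a * Real.sin a| ≤ a ^ 4 / 12 := by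
  have hd : ∀ x, HasDerivAt (fun x => 2 - 2 * Real.cos x - x * Real.sin x)
      (Real.sin x - x * Real.cos x) x := by
    intro x
    have h := (((hasDerivAt_const x (2 : ℝ)).fun_sub ((Real.hasDerivAt_cos x).const_mul 2)).fun_sub
      ((hasDerivAt_id' x).fun_mul (Real.hasDerivAt_sin x)))
    exact h.congr_deriv (by ring)
  have hp : ∀ x, HasDerivAt (fun x : ℝ => x ^ 4 / 12) (x ^ 3 / 3) x := by
    intro x
    exact ((hasDerivAt_pow 4 x).div_const 12).congr_deriv (by norm_num; ring)
  rw [abs_le]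
  constructor
  · have h := nonneg_of_deriv_nonneg (g := fun x => x ^ 4 / 12 + (2 - 2 * Real.cos x - x * Real.sin x))
      (g' := fun x => x ^ 3 / 3 + (Real.sin x - x * Real.cos x)) (by fun_prop)
      (fun x => (hp x).add (hd x)) (by simp) (fun x hx => by
        have := (abs_le.1 (abs_sin_sub_mul_cos_le hx.le)).1; linarith) ha
    linarith
  · have h := nonneg_of_deriv_nonneg (g := fun x => x ^ 4 / 12 - (2 - 2 * Real.cos x - x * Real.sin x))
      (g' := fun x => x ^ 3 / 3 - (Real.sin x - x * Real.cos x)) (by fun_prop)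
      (fun x => (hp x).sub (hd x)) (by simp) (fun x hx => by
        have := (abs_le.1 (abs_sin_sub_mul_cos_le hx.le)).2; linarith) ha
    linarith

/-- `|a cos a + 2a − 3 sin a| ≤ a⁵/60` for `a ≥ 0` (its derivative is `2 − 2cos a − a sin a`).
[folklore] -/
private theorem abs_mul_cos_add_le {a : ℝ} (ha : 0 ≤ a) :
    |a * Real.cos a + 2 * a - 3 * Real.sin a| ≤ a ^ 5 / 60 := by
  have hd : ∀ x, HasDerivAt (fun x => x * Real.cos x + 2 * x - 3 * Real.sin x)
      (2 - 2 * Real.cos x - x * Real.sin x) x := by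
    intro x
    have h' := ((((hasDerivAt_id' x).fun_mul (Real.hasDerivAt_cos x)).fun_add
      ((hasDerivAt_id' x).const_mul 2)).fun_sub ((Real.hasDerivAt_sin x).const_mul 3))
    exact h'.congr_deriv (by ring)
  have hp : ∀ x, HasDerivAt (fun x : ℝ => x ^ 5 / 60) (x ^ 4 / 12) x := by
    intro x
    exact ((hasDerivAt_pow 5 x).div_const 60).congr_deriv (by norm_num; ring)
  rw [abs_le]
  constructor
  · have h := nonneg_of_deriv_nonneg (g := fun x => x ^ 5 / 60 + (x * Real.cos x + 2 * x - 3 * Real.sin x))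
      (g' := fun x => x ^ 4 / 12 + (2 - 2 * Real.cos x - x * Real.sin x)) (by fun_prop)
      (fun x => (hp x).add (hd x)) (by simp) (fun x hx => by
        have := (abs_le.1 (abs_two_sub_le hx.le)).1; linarith) ha
    linarith
  · have h := nonneg_of_deriv_nonneg (g := fun x => x ^ 5 / 60 - (x * Real.cos x + 2 * x - 3 * Real.sin x))
      (g' := fun x => x ^ 4 / 12 - (2 - 2 * Real.cos x - x * Real.sin x)) (by fun_prop)
      (fun x => (hp x).sub (hd x)) (by simp) (fun x hx => by
        have := (abs_le.1 (abs_two_sub_le hx.le)).2; linarith) ha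
    linarith


/-- Mean-value device on `[0,∞)`: continuity on `[0,∞)`, a derivative on `(0,∞)` bounded by `C`
in modulus ⇒ `C`-Lipschitz on `[0,∞)`. [folklore] -/
private theorem abs_sub_le_of_deriv {f f' : ℝ → ℝ} {C : ℝ} (hc : ContinuousOn f (Ici 0))
    (hd : ∀ x, 0 < x → HasDerivAt f (f' x) x) (hb : ∀ x, 0 < x → |f' x| ≤ C)
    {x y : ℝ} (hx : 0 ≤ x) (hy : 0 ≤ y) : |f x - f y| ≤ C * |x - y| := by
  have hdiff : DifferentiableOn ℝ f (interior (Ici (0 : ℝ))) := by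
    rw [interior_Ici]
    exact fun z hz => (hd z hz).differentiableAt.differentiableWithinAt
  have hle : ∀ z ∈ interior (Ici (0 : ℝ)), deriv f z ≤ C := by
    rw [interior_Ici]
    exact fun z hz => by rw [(hd z hz).deriv]; exact (abs_le.1 (hb z hz)).2
  have hge : ∀ z ∈ interior (Ici (0 : ℝ)), -C ≤ deriv f z := by
    rw [interior_Ici]
    exact fun z hz => by rw [(hd z hz).deriv]; exact (abs_le.1 (hb z hz)).1
  have key : ∀ u v : ℝ, 0 ≤ u → 0 ≤ v → u ≤ v → |f u - f v| ≤ C * |u - v| := by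
    intro u v hu hv huv
    have h1 := (convex_Ici (0 : ℝ)).image_sub_le_mul_sub_of_deriv_le hc hdiff hle u hu v hv huv
    have h2 := (convex_Ici (0 : ℝ)).mul_sub_le_image_sub_of_le_deriv hc hdiff hge u hu v hv huv
    rw [abs_sub_comm, abs_of_nonpos (sub_nonpos.2 huv), neg_sub, abs_le]
    constructor <;> linarith
  rcases le_total x y with hxy | hxy
  · exact key x y hx hy hxy
  · rw [abs_sub_comm, abs_sub_comm x y]; exact key y x hy hx hxy

/-! #### The even branch `f_cos(λ) = cos √λ` in the `f(0) = 0` form -/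

/-- `\bar f_cos(x) := (cos √x − 1)/x` for `x > 0`, extended by its limit `−1/2` at `x ≤ 0`
(the function applied to `CC†` in the cosine sketch). [cite: ChiaEtAl2022, §4.5 proof strategy
after Corollary 4.16 ("`e^{iH} b = f_cos(H†H) b + f_sinc(H†H) H b`, where
`f_cos(λ) := cos(√λ)`"; held arXiv text p. 29 L39–45)] -/
def cosBar (x : ℝ) : ℝ := if 0 < x then (Real.cos (Real.sqrt x) - 1) / x else -1 / 2

/-- `f_cos − f_cos(0)` in product form: `cosSub x := x · \bar f_cos(x)` (`= cos √x − 1` for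
`x ≥ 0`). [cite: ChiaEtAl2022, §4.5 ("`f_cos(λ) := cos(√λ)`", p. 29 L44)] -/
def cosSub (x : ℝ) : ℝ := x * cosBar x

/-- `cosSub x = cos √x − 1` on `[0,∞)`. [cite: ChiaEtAl2022, §4.5 ("`f_cos(λ) := cos(√λ)`")] -/
theorem cosSub_eq {x : ℝ} (hx : 0 ≤ x) : cosSub x = Real.cos (Real.sqrt x) - 1 := by
  unfold cosSub cosBar
  rcases eq_or_lt_of_le hx with h0 | hpos
  · subst h0; simp
  · rw [if_pos hpos]; field_simp

/-- `cosBar` agrees with `(cos √x − 1)/x` on `(0,∞)`. [folklore] -/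
private theorem cosBar_of_pos {x : ℝ} (hx : 0 < x) :
    cosBar x = (Real.cos (Real.sqrt x) - 1) / x := if_pos hx

/-- Right-continuity estimate at `0`: `|\bar f_cos(y) + 1/2| ≤ (5/96)·y` for `0 < y ≤ 1`
(`|cos a − (1 − a²/2)| ≤ (5/96)a⁴` at `a = √y`). [folklore] -/
private theorem abs_cosBar_add_half_le {y : ℝ} (hy : 0 < y) (hy1 : y ≤ 1) :
    |cosBar y + 1 / 2| ≤ 5 / 96 * y := by
  rw [cosBar_of_pos hy]
  set a := Real.sqrt y with ha
  have ha0 : 0 < a := Real.sqrt_pos.2 hy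
  have hy' : y = a ^ 2 := (Real.sq_sqrt hy.le).symm
  have ha1 : |a| ≤ 1 := by
    rw [abs_of_pos ha0, ha, ← Real.sqrt_one]; exact Real.sqrt_le_sqrt hy1
  have hb := Real.cos_bound ha1
  rw [abs_of_pos ha0] at hb
  have heq : (Real.cos a - 1) / y + 1 / 2 = (Real.cos a - (1 - a ^ 2 / 2)) / a ^ 2 := by
    rw [hy']; field_simp; ring
  rw [heq, abs_div, abs_of_pos (by positivity : (0 : ℝ) < a ^ 2), div_le_iff₀ (by positivity)]
  calc |Real.cos a - (1 - a ^ 2 / 2)| ≤ a ^ 4 * (5 / 96) := hb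
    _ = 5 / 96 * y * a ^ 2 := by rw [hy']; ring

/-- `\bar f_cos` is continuous on `[0,∞)`. [folklore] -/
private theorem continuousOn_cosBar : ContinuousOn cosBar (Ici 0) := by
  intro x hx
  rcases eq_or_lt_of_le (mem_Ici.1 hx) with h0 | hpos
  · -- at `0`: squeeze
    subst h0
    rw [Metric.continuousWithinAt_iff]
    intro ε hε
    refine ⟨min 1 (ε / (5 / 96 + 1)), by positivity, fun y hy hdist => ?_⟩
    have hy0 : 0 ≤ y := hy
    rw [Real.dist_eq, sub_zero] at hdist
    rw [Real.dist_eq, show cosBar 0 = -1 / 2 by simp [cosBar]]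
    rcases eq_or_lt_of_le hy0 with h | hypos
    · subst h; simp [cosBar, hε]
    rw [abs_of_pos hypos] at hdist
    have hy1 : y ≤ 1 := (hdist.trans_le (min_le_left _ _)).le
    have hyε : y < ε / (5 / 96 + 1) := hdist.trans_le (min_le_right _ _)
    calc |cosBar y - -1 / 2| = |cosBar y + 1 / 2| := by ring_nf
      _ ≤ 5 / 96 * y := abs_cosBar_add_half_le hypos hy1
      _ < ε := by
          rw [lt_div_iff₀ (by norm_num)] at hyε
          nlinarith
  · -- on `(0,∞)`: the formula
    have hev : cosBar =ᶠ[nhds x] fun y => (Real.cos (Real.sqrt y) - 1) / y :=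
      Filter.eventually_of_mem (Ioi_mem_nhds hpos) fun y hy => cosBar_of_pos hy
    refine ContinuousAt.continuousWithinAt ?_
    refine (ContinuousAt.congr ?_ hev.symm)
    have : ContinuousAt (fun y => (Real.cos (Real.sqrt y) - 1) / y) x := by
      refine ContinuousAt.div (by fun_prop) continuousAt_id hpos.ne'
    exact this

/-- The derivative of `\bar f_cos` on `(0,∞)`: `(2 − 2cos a − a sin a)/(2a⁴)` at `a = √x`.
[folklore] -/
private theorem hasDerivAt_cosBar {x : ℝ} (hx : 0 < x) :
    HasDerivAt cosBar ((2 - 2 * Real.cos (Real.sqrt x) - Real.sqrt x * Real.sin (Real.sqrt x)) /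
      (2 * Real.sqrt x ^ 4)) x := by
  have hs := Real.hasDerivAt_sqrt hx.ne'
  have h := ((hs.cos).sub_const 1).fun_div (hasDerivAt_id' x) hx.ne'
  have hev : cosBar =ᶠ[nhds x] fun y => (Real.cos (Real.sqrt y) - 1) / y :=
    Filter.eventually_of_mem (Ioi_mem_nhds hx) fun y hy => cosBar_of_pos hy
  refine (h.congr_of_eventuallyEq hev).congr_deriv ?_
  have ha0 : 0 < Real.sqrt x := Real.sqrt_pos.2 hx
  have hx' : x = Real.sqrt x ^ 2 := (Real.sq_sqrt hx.le).symm
  set a := Real.sqrt x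
  rw [hx']
  field_simp
  ring

/-- **Smoothness of `\bar f_cos`**: `|\bar f_cos'| ≤ 1/24` on `(0,∞)`, hence `\bar f_cos` is
`1/24`-Lipschitz on `[0,∞)` — the constant `1/24` of the printed display
`|\bar f_cos'(x)| ≤ min(1/24, 5/(2x^{3/2}))`. [cite: ChiaEtAl2022, §4.5 display after "we will use
the following bounds on the smoothness of `f_cos` and `f_sinc`" (second line; p. 29 L50)] -/
theorem abs_cosBar_sub_le {x y : ℝ} (hx : 0 ≤ x) (hy : 0 ≤ y) :
    |cosBar x - cosBar y| ≤ 1 / 24 * |x - y| := by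
  refine abs_sub_le_of_deriv continuousOn_cosBar (fun z hz => hasDerivAt_cosBar hz) ?_ hx hy
  intro z hz
  have ha0 : 0 < Real.sqrt z := Real.sqrt_pos.2 hz
  set a := Real.sqrt z
  have hnum := abs_two_sub_le ha0.le
  rw [abs_div, abs_of_pos (by positivity : (0 : ℝ) < 2 * a ^ 4), div_le_iff₀ (by positivity)]
  calc |2 - 2 * Real.cos a - a * Real.sin a| ≤ a ^ 4 / 12 := hnum
    _ = 1 / 24 * (2 * a ^ 4) := by ring

/-- `cosSub` is continuous on `[0,∞)` (it is `cos √x − 1` there). [folklore] -/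
private theorem continuousOn_cosSub : ContinuousOn cosSub (Ici 0) :=
  (ContinuousOn.congr (f := fun x => Real.cos (Real.sqrt x) - 1) (by fun_prop)
    (fun x hx => cosSub_eq hx))

/-- The derivative of `cosSub` on `(0,∞)`: `−sin a/(2a)` at `a = √x`. [folklore] -/
private theorem hasDerivAt_cosSub {x : ℝ} (hx : 0 < x) :
    HasDerivAt cosSub (-Real.sin (Real.sqrt x) / (2 * Real.sqrt x)) x := by
  have hs := Real.hasDerivAt_sqrt hx.ne'
  have h := (hs.cos).sub_const 1
  have hev : cosSub =ᶠ[nhds x] fun y => Real.cos (Real.sqrt y) - 1 :=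
    Filter.eventually_of_mem (Ioi_mem_nhds hx) fun y hy => cosSub_eq (le_of_lt hy)
  refine (h.congr_of_eventuallyEq hev).congr_deriv ?_
  have ha0 : 0 < Real.sqrt x := Real.sqrt_pos.2 hx
  field_simp

/-- **Smoothness of `f_cos`**: `|f_cos'| ≤ 1/2` on `(0,∞)` (`|sin a| ≤ a`), hence
`cosSub = f_cos − 1` is `1/2`-Lipschitz on `[0,∞)` — the printed
`|f_cos'(x)| ≤ min(1/2, 1/(2√x))`. [cite: ChiaEtAl2022, §4.5 smoothness display (first line;
p. 29 L48)] -/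
theorem abs_cosSub_sub_le {x y : ℝ} (hx : 0 ≤ x) (hy : 0 ≤ y) :
    |cosSub x - cosSub y| ≤ 1 / 2 * |x - y| := by
  refine abs_sub_le_of_deriv continuousOn_cosSub (fun z hz => hasDerivAt_cosSub hz) ?_ hx hy
  intro z hz
  have ha0 : 0 < Real.sqrt z := Real.sqrt_pos.2 hz
  set a := Real.sqrt z
  have hsin : |Real.sin a| ≤ a := by
    have := Real.abs_sin_le_abs (x := a); rwa [abs_of_pos ha0] at this
  rw [abs_div, abs_neg, abs_of_pos (by positivity : (0 : ℝ) < 2 * a), div_le_iff₀ (by positivity)]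
  linarith

/-! #### The odd branch `f_sinc(λ) = sinc √λ` in the `f(0) = 0` form -/

/-- `\bar f_sinc(x) := (sinc √x − 1)/x` for `x > 0`, extended by its limit `−1/6` at `x ≤ 0`
(the function applied to `CC†` in the sinc sketch). [cite: ChiaEtAl2022, §4.5
("`f_sinc(λ) := sinc(√λ)`", p. 29 L44)] -/
def sincBar (x : ℝ) : ℝ := if 0 < x then (Real.sinc (Real.sqrt x) - 1) / x else -1 / 6

/-- `f_sinc − f_sinc(0)` in product form: `sincSub x := x · \bar f_sinc(x)` (`= sinc √x − 1` for
`x ≥ 0`). [cite: ChiaEtAl2022, §4.5 ("`f_sinc(λ) := sinc(√λ)`", p. 29 L44)] -/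
def sincSub (x : ℝ) : ℝ := x * sincBar x

/-- `sincSub x = sinc √x − 1` on `[0,∞)`. [cite: ChiaEtAl2022, §4.5 ("`f_sinc(λ) := sinc(√λ)`")] -/
theorem sincSub_eq {x : ℝ} (hx : 0 ≤ x) : sincSub x = Real.sinc (Real.sqrt x) - 1 := by
  unfold sincSub sincBar
  rcases eq_or_lt_of_le hx with h0 | hpos
  · subst h0; simp
  · rw [if_pos hpos]; field_simp

/-- `sincBar` agrees with `(sin √x/√x − 1)/x` on `(0,∞)`. [folklore] -/
private theorem sincBar_of_pos {x : ℝ} (hx : 0 < x) :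
    sincBar x = (Real.sin (Real.sqrt x) / Real.sqrt x - 1) / x := by
  unfold sincBar; rw [if_pos hx, Real.sinc_of_ne_zero (Real.sqrt_pos.2 hx).ne']

/-- `sincSub` agrees with `sin √x/√x − 1` on `(0,∞)`. [folklore] -/
private theorem sincSub_of_pos {x : ℝ} (hx : 0 < x) :
    sincSub x = Real.sin (Real.sqrt x) / Real.sqrt x - 1 := by
  rw [sincSub_eq hx.le, Real.sinc_of_ne_zero (Real.sqrt_pos.2 hx).ne']

/-- Right-continuity estimate at `0`: `|\bar f_sinc(y) + 1/6| ≤ y/100` for `0 < y ≤ 1`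
(`|sin a − (a − a³/6)| ≤ a⁵/100` at `a = √y`). [folklore] -/
private theorem abs_sincBar_add_sixth_le {y : ℝ} (hy : 0 < y) (hy1 : y ≤ 1) :
    |sincBar y + 1 / 6| ≤ y / 100 := by
  rw [sincBar_of_pos hy]
  set a := Real.sqrt y with ha
  have ha0 : 0 < a := Real.sqrt_pos.2 hy
  have hy' : y = a ^ 2 := (Real.sq_sqrt hy.le).symm
  have ha1 : |a| ≤ 1 := by
    rw [abs_of_pos ha0, ha, ← Real.sqrt_one]; exact Real.sqrt_le_sqrt hy1
  have hb := Real.sin_bound ha1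
  rw [abs_of_pos ha0] at hb
  have heq : (Real.sin a / a - 1) / y + 1 / 6 = (Real.sin a - (a - a ^ 3 / 6)) / a ^ 3 := by
    rw [hy']; field_simp; ring
  rw [heq, abs_div, abs_of_pos (by positivity : (0 : ℝ) < a ^ 3), div_le_iff₀ (by positivity)]
  calc |Real.sin a - (a - a ^ 3 / 6)| ≤ a ^ 5 / 100 := hb
    _ = y / 100 * a ^ 3 := by rw [hy']; ring

/-- `\bar f_sinc` is continuous on `[0,∞)`. [folklore] -/
private theorem continuousOn_sincBar : ContinuousOn sincBar (Ici 0) := by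
  intro x hx
  rcases eq_or_lt_of_le (mem_Ici.1 hx) with h0 | hpos
  · subst h0
    rw [Metric.continuousWithinAt_iff]
    intro ε hε
    refine ⟨min 1 (ε / (1 / 100 + 1)), by positivity, fun y hy hdist => ?_⟩
    have hy0 : 0 ≤ y := hy
    rw [Real.dist_eq, sub_zero] at hdist
    rw [Real.dist_eq, show sincBar 0 = -1 / 6 by simp [sincBar]]
    rcases eq_or_lt_of_le hy0 with h | hypos
    · subst h; simp [sincBar, hε]
    rw [abs_of_pos hypos] at hdist
    have hy1 : y ≤ 1 := (hdist.trans_le (min_le_left _ _)).le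
    have hyε : y < ε / (1 / 100 + 1) := hdist.trans_le (min_le_right _ _)
    calc |sincBar y - -1 / 6| = |sincBar y + 1 / 6| := by ring_nf
      _ ≤ y / 100 := abs_sincBar_add_sixth_le hypos hy1
      _ < ε := by
          rw [lt_div_iff₀ (by norm_num)] at hyε
          nlinarith
  · have hev : sincBar =ᶠ[nhds x] fun y => (Real.sin (Real.sqrt y) / Real.sqrt y - 1) / y :=
      Filter.eventually_of_mem (Ioi_mem_nhds hpos) fun y hy => sincBar_of_pos hy
    refine ContinuousAt.continuousWithinAt (ContinuousAt.congr ?_ hev.symm)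
    have hsx : Real.sqrt x ≠ 0 := (Real.sqrt_pos.2 hpos).ne'
    exact ContinuousAt.div (((by fun_prop : ContinuousAt (fun y => Real.sin (Real.sqrt y)) x).div
      (by fun_prop) hsx).sub continuousAt_const) continuousAt_id hpos.ne'

/-- The derivative of `\bar f_sinc` on `(0,∞)`: `(a cos a + 2a − 3 sin a)/(2a⁵)` at `a = √x`.
[folklore] -/
private theorem hasDerivAt_sincBar {x : ℝ} (hx : 0 < x) :
    HasDerivAt sincBar ((Real.sqrt x * Real.cos (Real.sqrt x) + 2 * Real.sqrt x -
      3 * Real.sin (Real.sqrt x)) / (2 * Real.sqrt x ^ 5)) x := by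
  have hs := Real.hasDerivAt_sqrt hx.ne'
  have ha0 : 0 < Real.sqrt x := Real.sqrt_pos.2 hx
  have h := (((hs.sin).fun_div hs ha0.ne').sub_const 1).fun_div (hasDerivAt_id' x) hx.ne'
  have hev : sincBar =ᶠ[nhds x] fun y => (Real.sin (Real.sqrt y) / Real.sqrt y - 1) / y :=
    Filter.eventually_of_mem (Ioi_mem_nhds hx) fun y hy => sincBar_of_pos hy
  refine (h.congr_of_eventuallyEq hev).congr_deriv ?_
  have hx' : x = Real.sqrt x ^ 2 := (Real.sq_sqrt hx.le).symm
  set a := Real.sqrt x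
  rw [hx']
  field_simp
  ring

/-- **Smoothness of `\bar f_sinc`**: `|\bar f_sinc'| ≤ 1/120` on `(0,∞)`, hence `\bar f_sinc` is
`1/120`-Lipschitz on `[0,∞)`; the print displays the weaker `|\bar f_sinc'(x)| ≤ min(1/60, 3/x²)`,
which follows. [cite: ChiaEtAl2022, §4.5 smoothness display (fourth line; p. 29 L54)] -/
theorem abs_sincBar_sub_le {x y : ℝ} (hx : 0 ≤ x) (hy : 0 ≤ y) :
    |sincBar x - sincBar y| ≤ 1 / 120 * |x - y| := by
  refine abs_sub_le_of_deriv continuousOn_sincBar (fun z hz => hasDerivAt_sincBar hz) ?_ hx hy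
  intro z hz
  have ha0 : 0 < Real.sqrt z := Real.sqrt_pos.2 hz
  set a := Real.sqrt z
  have hnum := abs_mul_cos_add_le ha0.le
  rw [abs_div, abs_of_pos (by positivity : (0 : ℝ) < 2 * a ^ 5), div_le_iff₀ (by positivity)]
  calc |a * Real.cos a + 2 * a - 3 * Real.sin a| ≤ a ^ 5 / 60 := hnum
    _ = 1 / 120 * (2 * a ^ 5) := by ring

/-- `sincSub` is continuous on `[0,∞)` (it is `sinc √x − 1` there). [folklore] -/
private theorem continuousOn_sincSub : ContinuousOn sincSub (Ici 0) :=
  (ContinuousOn.congr (f := fun x => Real.sinc (Real.sqrt x) - 1)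
    ((Real.continuous_sinc.comp Real.continuous_sqrt).sub continuous_const).continuousOn
    (fun _ hx => sincSub_eq hx))

/-- The derivative of `sincSub` on `(0,∞)`: `(a cos a − sin a)/(2a³)` at `a = √x`. [folklore] -/
private theorem hasDerivAt_sincSub {x : ℝ} (hx : 0 < x) :
    HasDerivAt sincSub ((Real.sqrt x * Real.cos (Real.sqrt x) - Real.sin (Real.sqrt x)) /
      (2 * Real.sqrt x ^ 3)) x := by
  have hs := Real.hasDerivAt_sqrt hx.ne'
  have ha0 : 0 < Real.sqrt x := Real.sqrt_pos.2 hx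
  have h := ((hs.sin).fun_div hs ha0.ne').sub_const 1
  have hev : sincSub =ᶠ[nhds x] fun y => Real.sin (Real.sqrt y) / Real.sqrt y - 1 :=
    Filter.eventually_of_mem (Ioi_mem_nhds hx) fun y hy => sincSub_of_pos hy
  refine (h.congr_of_eventuallyEq hev).congr_deriv ?_
  have hx' : x = Real.sqrt x ^ 2 := (Real.sq_sqrt hx.le).symm
  set a := Real.sqrt x
  field_simp

/-- **Smoothness of `f_sinc`**: `|f_sinc'| ≤ 1/6` on `(0,∞)` (`|a cos a − sin a| ≤ a³/3`), hence
`sincSub = f_sinc − 1` is `1/6`-Lipschitz on `[0,∞)`; the print displays the weaker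
`|f_sinc'(x)| ≤ min(1/4, 1/x)`, which follows. [cite: ChiaEtAl2022, §4.5 smoothness display (third
line; p. 29 L52)] -/
theorem abs_sincSub_sub_le {x y : ℝ} (hx : 0 ≤ x) (hy : 0 ≤ y) :
    |sincSub x - sincSub y| ≤ 1 / 6 * |x - y| := by
  refine abs_sub_le_of_deriv continuousOn_sincSub (fun z hz => hasDerivAt_sincSub hz) ?_ hx hy
  intro z hz
  have ha0 : 0 < Real.sqrt z := Real.sqrt_pos.2 hz
  set a := Real.sqrt z
  have hnum : |a * Real.cos a - Real.sin a| ≤ a ^ 3 / 3 := by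
    rw [abs_sub_comm]; exact abs_sin_sub_mul_cos_le ha0.le
  rw [abs_div, abs_of_pos (by positivity : (0 : ℝ) < 2 * a ^ 3), div_le_iff₀ (by positivity)]
  calc |a * Real.cos a - Real.sin a| ≤ a ^ 3 / 3 := hnum
    _ = 1 / 6 * (2 * a ^ 3) := by ring


/-! ### §2 Reading the two targets on a symmetric `H`: `f_cos(HᵀH) = cos H − I`,
`f_sinc(HᵀH) = sinc H − I`, and `H · sinc H = sin H` -/

variable {n : ℕ}

/-- `sinc |x| = sinc x`. [folklore] -/
private theorem sinc_abs (x : ℝ) : Real.sinc |x| = Real.sinc x := by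
  rcases abs_choice x with h | h
  · rw [h]
  · rw [h, Real.sinc_neg]

/-- `x · sinc x = sin x`. [folklore] -/
private theorem mul_sinc (x : ℝ) : x * Real.sinc x = Real.sin x := by
  rcases eq_or_ne x 0 with h | h
  · subst h; simp
  · rw [Real.sinc_of_ne_zero h]; field_simp

/-- A real symmetric matrix is its own transpose. [folklore] -/
private theorem transpose_eq_of_isHermitian {H : Matrix (Fin n) (Fin n) ℝ} (hH : H.IsHermitian) :
    Hᵀ = H := by
  rw [← Matrix.conjTranspose_eq_transpose_of_trivial]; exact hH.eq

/-- **Even target, read on `H`.**  For real symmetric `H`, the even singular value transformation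
`f_cos(HᵀH) − I` (here `cosSub (HᵀH)`, continuous functional calculus) is `cos H − I`:
`cos √(λ²) = cos |λ| = cos λ` on the spectrum. [cite: ChiaEtAl2022, §4.5
("`e^{iH} b = cos(H) b + i·sinc(H) H b = f_cos(H†H) b + f_sinc(H†H) H b`, where
`f_cos(λ) := cos(√λ)`", held arXiv text p. 29 L40–45)] -/
theorem cfc_cosSub_gram {H : Matrix (Fin n) (Fin n) ℝ} (hH : H.IsHermitian) :
    cfc cosSub (Hᵀ * H) = cfc Real.cos H - 1 := by
  have ha : IsSelfAdjoint H := hH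
  rw [transpose_eq_of_isHermitian hH, ← sq]
  rw [← cfc_comp_pow cosSub 2 H (hf := (H.finite_real_spectrum.image _).continuousOn _) ha]
  have h1 : cfc (fun x : ℝ => cosSub (x ^ 2)) H = cfc (fun x : ℝ => Real.cos x - 1) H :=
    cfc_congr fun x _ => by
      rw [cosSub_eq (sq_nonneg x), Real.sqrt_sq_eq_abs, Real.cos_abs]
  rw [h1, cfc_sub Real.cos (fun _ : ℝ => (1 : ℝ)) H, cfc_const_one ℝ H]

/-- **Odd target, read on `H` (the even factor).**  For real symmetric `H`,
`f_sinc(HᵀH) − I` (here `sincSub (HᵀH)`) is `sinc H − I`: `sinc √(λ²) = sinc |λ| = sinc λ`.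
[cite: ChiaEtAl2022, §4.5 ("`f_sinc(λ) := sinc(√λ)`", p. 29 L44–45)] -/
theorem cfc_sincSub_gram {H : Matrix (Fin n) (Fin n) ℝ} (hH : H.IsHermitian) :
    cfc sincSub (Hᵀ * H) = cfc Real.sinc H - 1 := by
  have ha : IsSelfAdjoint H := hH
  rw [transpose_eq_of_isHermitian hH, ← sq]
  rw [← cfc_comp_pow sincSub 2 H (hf := (H.finite_real_spectrum.image _).continuousOn _) ha]
  have h1 : cfc (fun x : ℝ => sincSub (x ^ 2)) H = cfc (fun x : ℝ => Real.sinc x - 1) H :=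
    cfc_congr fun x _ => by
      rw [sincSub_eq (sq_nonneg x), Real.sqrt_sq_eq_abs, sinc_abs]
  rw [h1, cfc_sub Real.sinc (fun _ : ℝ => (1 : ℝ)) H, cfc_const_one ℝ H]

/-- **Odd target, the odd factor restored: `H · sinc(H) = sin(H)`** (`λ · sinc λ = sin λ` on the
spectrum; continuous functional calculus is multiplicative). [cite: ChiaEtAl2022, §4.5
("`e^{iH} b = cos(H) b + i·sinc(H) H b`", p. 29 L40–43)] -/
theorem mul_cfc_sinc {H : Matrix (Fin n) (Fin n) ℝ} (hH : H.IsHermitian) :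
    H * cfc Real.sinc H = cfc Real.sin H := by
  have ha : IsSelfAdjoint H := hH
  have h1 : cfc Real.sin H = cfc (fun x : ℝ => x * Real.sinc x) H :=
    cfc_congr fun x _ => (mul_sinc x).symm
  rw [h1, cfc_mul (fun x : ℝ => x) Real.sinc H, cfc_id' ℝ (a := H)]

/-! ### §3 The two sketches (Problem 4.14 / Corollary 4.16 at the matrix level, Frobenius form) -/

variable {s c : ℕ} {φ : ℝ} {H : Matrix (Fin n) (Fin n) ℝ}

/-- **Cosine sketch (even branch of `e^{iH}`).**  Let `SQ_φ(H)` be given for a real symmetric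
`H ≠ 0` (witness `H̃`), `δ ∈ (0,1]`, `ε > 0`, and sample sizes
`s ≥ 8φ²‖H‖_F⁴log(6/δ)/ε²`, `s ≥ 2φ²log(3/δ)`, `c ≥ (2/9)φ⁶‖H‖_F⁸log(6/δ)/ε²`.  Sampling
`ω ∈ [n]^s` from `𝒟_h̃` (`R = S_ωH`) and then `τ ∈ [n]^c` from the row-norm distribution of
`(S_ωH̃)ᵀ` (`C = RT_τᵀ`), the two-stage mass of `‖Rᵀ · \bar f_cos(CCᵀ) · R + I − cos H‖_F ≤ ε`
exceeds `1 − δ`.  This is the host theorem `even_singular_value_transformation_sample_complexity`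
at `f = cosSub` (`L = 1/2`), `\bar f = cosBar` (`\bar L = 1/24`), with `f_cos(HᵀH) − I = cos H − I`
(`cfc_cosSub_gram`) — the printed `r_cos = Õ(‖H‖_F²t²ε⁻²log(1/δ))`,
`c_cos = Õ(‖H‖_F²t⁶ε⁻²log(1/δ))` (`t = ‖H‖`) with constants, in the host's Frobenius currency
(every operator norm `t² = ‖H‖²` of the print appears as `φ‖H‖_F²`).
[cite: ChiaEtAl2022, §4.5 Problem 4.14, Corollary 4.16 and its proof ("we can find `R_cos`,
`C_cos` … such that `‖R_cos† \bar f_cos(C_cos C_cos†) R_cos + I − f_cos(H†H)‖ ≤ ε` … where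
`r_cos = Õ(‖H‖_F² t² ε⁻² log(1/δ))`, `c_cos = Õ(‖H‖_F² t⁶ ε⁻² log(1/δ))`"; held arXiv text
p. 29 L16–19, L31–33, L57–71)] -/
theorem cos_sketch (W : MatrixOversamplingWitness φ H) (hH : H.IsHermitian) (hA : H ≠ 0)
    (hs : 0 < s) (hc : 0 < c) {δ ε : ℝ} (hδ : 0 < δ) (hδ1 : δ ≤ 1) (hε : 0 < ε)
    (hsL : 8 * φ ^ 2 * frobSq H ^ 2 * Real.log (6 / δ) / ε ^ 2 ≤ s)
    (hs3 : 2 * φ ^ 2 * Real.log (3 / δ) ≤ s)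
    (hcL : 2 / 9 * φ ^ 6 * frobSq H ^ 4 * Real.log (6 / δ) / ε ^ 2 ≤ c) :
    1 - δ <
      ∑ ω : Fin s → Fin n, iidWeight (rowDist W.tilde) ω *
        ∑ τ ∈ univ.filter (fun τ : Fin c → Fin n =>
          Real.sqrt (frobSq ((sketch (rowDist W.tilde) ω * H)ᵀ *
              cfc cosBar ((sketch (rowDist (sketch (rowDist W.tilde) ω * W.tilde)ᵀ) τ *
                  (sketch (rowDist W.tilde) ω * H)ᵀ)ᵀ *
                (sketch (rowDist (sketch (rowDist W.tilde) ω * W.tilde)ᵀ) τ *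
                  (sketch (rowDist W.tilde) ω * H)ᵀ)) *
              (sketch (rowDist W.tilde) ω * H) + 1 - cfc Real.cos H)) ≤ ε),
          iidWeight (rowDist (sketch (rowDist W.tilde) ω * W.tilde)ᵀ) τ := by
  classical
  have hL0 : (0 : ℝ) ≤ 1 / 2 := by norm_num
  have hLb0 : (0 : ℝ) ≤ 1 / 24 := by norm_num
  have hL : ∀ x y : ℝ, 0 ≤ x → 0 ≤ y → |cosSub x - cosSub y| ≤ 1 / 2 * |x - y| :=
    fun x y hx hy => abs_cosSub_sub_le hx hy
  have hLb : ∀ x y : ℝ, 0 ≤ x → 0 ≤ y → |cosBar x - cosBar y| ≤ 1 / 24 * |x - y| :=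
    fun x y hx hy => abs_cosBar_sub_le hx hy
  have hff : ∀ x : ℝ, 0 ≤ x → x * cosBar x = cosSub x := fun x _ => rfl
  have hsL' : 32 * φ ^ 2 * (1 / 2 : ℝ) ^ 2 * frobSq H ^ 2 * Real.log (6 / δ) / ε ^ 2 ≤ s := by
    have : 32 * φ ^ 2 * (1 / 2 : ℝ) ^ 2 * frobSq H ^ 2 * Real.log (6 / δ) / ε ^ 2 =
        8 * φ ^ 2 * frobSq H ^ 2 * Real.log (6 / δ) / ε ^ 2 := by ring
    rw [this]; exact hsL
  have hcL' : 128 * φ ^ 6 * (1 / 24 : ℝ) ^ 2 * frobSq H ^ 4 * Real.log (6 / δ) / ε ^ 2 ≤ c := by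
    have : 128 * φ ^ 6 * (1 / 24 : ℝ) ^ 2 * frobSq H ^ 4 * Real.log (6 / δ) / ε ^ 2 =
        2 / 9 * φ ^ 6 * frobSq H ^ 4 * Real.log (6 / δ) / ε ^ 2 := by ring
    rw [this]; exact hcL
  have key := even_singular_value_transformation_sample_complexity W hA hs hc hδ hδ1 hε
    cosSub cosBar hL0 hL hLb0 hLb hff hsL' hs3 hcL'
  have hId := cfc_cosSub_gram hH
  simp_rw [hId, sub_sub_eq_add_sub] at key
  exact key

/-- **Sinc sketch (odd branch of `e^{iH}`, even factor).**  Same sampling scheme, with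
`s ≥ (8/9)φ²‖H‖_F⁴log(6/δ)/ε²`, `s ≥ 2φ²log(3/δ)`, `c ≥ (2/225)φ⁶‖H‖_F⁸log(6/δ)/ε²`: the
two-stage mass of `‖R'ᵀ · \bar f_sinc(C'C'ᵀ) · R' + I − sinc H‖_F ≤ ε` exceeds `1 − δ` — the
host theorem at `f = sincSub` (`L = 1/6`), `\bar f = sincBar` (`\bar L = 1/120`) with
`f_sinc(HᵀH) − I = sinc H − I` (`cfc_sincSub_gram`); the printed `r_sinc = Õ(‖H‖_F²t⁴ε⁻²log(1/δ))`,
`c_sinc = Õ(‖H‖_F²t⁸ε⁻²log(1/δ))` are this statement at accuracy `ε/t` (below, `ε/‖H‖_F`).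
[cite: ChiaEtAl2022, §4.5 proof of Corollary 4.16 ("`‖R_sinc† \bar f_sinc(C_sinc C_sinc†) R_sinc
+ I − f_sinc(H†H)‖ ≤ ε/t` where `r_sinc = Õ(‖H‖_F² t⁴ ε⁻² log(1/δ))`,
`c_sinc = Õ(‖H‖_F² t⁸ ε⁻² log(1/δ))`"; p. 29 L57–71)] -/
theorem sinc_sketch (W : MatrixOversamplingWitness φ H) (hH : H.IsHermitian) (hA : H ≠ 0)
    (hs : 0 < s) (hc : 0 < c) {δ ε : ℝ} (hδ : 0 < δ) (hδ1 : δ ≤ 1) (hε : 0 < ε)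
    (hsL : 8 / 9 * φ ^ 2 * frobSq H ^ 2 * Real.log (6 / δ) / ε ^ 2 ≤ s)
    (hs3 : 2 * φ ^ 2 * Real.log (3 / δ) ≤ s)
    (hcL : 2 / 225 * φ ^ 6 * frobSq H ^ 4 * Real.log (6 / δ) / ε ^ 2 ≤ c) :
    1 - δ <
      ∑ ω : Fin s → Fin n, iidWeight (rowDist W.tilde) ω *
        ∑ τ ∈ univ.filter (fun τ : Fin c → Fin n =>
          Real.sqrt (frobSq ((sketch (rowDist W.tilde) ω * H)ᵀ *
              cfc sincBar ((sketch (rowDist (sketch (rowDist W.tilde) ω * W.tilde)ᵀ) τ *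
                  (sketch (rowDist W.tilde) ω * H)ᵀ)ᵀ *
                (sketch (rowDist (sketch (rowDist W.tilde) ω * W.tilde)ᵀ) τ *
                  (sketch (rowDist W.tilde) ω * H)ᵀ)) *
              (sketch (rowDist W.tilde) ω * H) + 1 - cfc Real.sinc H)) ≤ ε),
          iidWeight (rowDist (sketch (rowDist W.tilde) ω * W.tilde)ᵀ) τ := by
  classical
  have hL0 : (0 : ℝ) ≤ 1 / 6 := by norm_num
  have hLb0 : (0 : ℝ) ≤ 1 / 120 := by norm_num
  have hL : ∀ x y : ℝ, 0 ≤ x → 0 ≤ y → |sincSub x - sincSub y| ≤ 1 / 6 * |x - y| :=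
    fun x y hx hy => abs_sincSub_sub_le hx hy
  have hLb : ∀ x y : ℝ, 0 ≤ x → 0 ≤ y → |sincBar x - sincBar y| ≤ 1 / 120 * |x - y| :=
    fun x y hx hy => abs_sincBar_sub_le hx hy
  have hff : ∀ x : ℝ, 0 ≤ x → x * sincBar x = sincSub x := fun x _ => rfl
  have hsL' : 32 * φ ^ 2 * (1 / 6 : ℝ) ^ 2 * frobSq H ^ 2 * Real.log (6 / δ) / ε ^ 2 ≤ s := by
    have : 32 * φ ^ 2 * (1 / 6 : ℝ) ^ 2 * frobSq H ^ 2 * Real.log (6 / δ) / ε ^ 2 =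
        8 / 9 * φ ^ 2 * frobSq H ^ 2 * Real.log (6 / δ) / ε ^ 2 := by ring
    rw [this]; exact hsL
  have hcL' : 128 * φ ^ 6 * (1 / 120 : ℝ) ^ 2 * frobSq H ^ 4 * Real.log (6 / δ) / ε ^ 2 ≤ c := by
    have : 128 * φ ^ 6 * (1 / 120 : ℝ) ^ 2 * frobSq H ^ 4 * Real.log (6 / δ) / ε ^ 2 =
        2 / 225 * φ ^ 6 * frobSq H ^ 4 * Real.log (6 / δ) / ε ^ 2 := by ring
    rw [this]; exact hcL
  have key := even_singular_value_transformation_sample_complexity W hA hs hc hδ hδ1 hε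
    sincSub sincBar hL0 hL hLb0 hLb hff hsL' hs3 hcL'
  have hId := cfc_sincSub_gram hH
  simp_rw [hId, sub_sub_eq_add_sub] at key
  exact key

/-- **Assembly of the odd branch (deterministic).**  If `M_s` is any matrix with
`‖M_s + I − sinc H‖_F ≤ ε'` (e.g. the sinc-sketch output `R'ᵀ \bar f_sinc(C'C'ᵀ) R'`), then
`‖H·(M_s + I) − sin H‖_F ≤ ‖H‖_F · ε'` — the print's "`‖·‖ ≤ ε/t`, then multiply by `H`
(`‖H‖ = t`)" step, with the operator norm `‖H‖` relaxed to `‖H‖_F` (Frobenius submultiplicativity,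
as everywhere on the tree's SQ shelf). [cite: ChiaEtAl2022, §4.5 proof of Corollary 4.16
(display "As a consequence", p. 29 L72–75: the `f_sinc` error enters multiplied by `H`)] -/
theorem sin_error_le (hH : H.IsHermitian) (Ms : Matrix (Fin n) (Fin n) ℝ) {ε' : ℝ}
    (h : Real.sqrt (frobSq (Ms + 1 - cfc Real.sinc H)) ≤ ε') :
    Real.sqrt (frobSq (H * (Ms + 1) - cfc Real.sin H)) ≤ Real.sqrt (frobSq H) * ε' := by
  have heq : H * (Ms + 1) - cfc Real.sin H = H * (Ms + 1 - cfc Real.sinc H) := by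
    rw [← mul_cfc_sinc hH, Matrix.mul_sub]
  rw [heq]
  exact (sqrt_frobSq_mul_le H _).trans (mul_le_mul_of_nonneg_left h (Real.sqrt_nonneg _))


/-! ### §4 The complex reading `e^{iH} ≈ (M_cos + I) + i·H·(M_sinc + I)` and the displayed cost -/

section ComplexReading

open scoped Matrix.Norms.Frobenius

/-- Bridge: `√(frobSq M)` is Mathlib's (scoped) Frobenius norm `‖M‖`. [folklore] -/
private theorem sqrt_frobSq_eq_norm' {k l : ℕ} (M : Matrix (Fin k) (Fin l) ℝ) :
    Real.sqrt (frobSq M) = ‖M‖ := by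
  rw [Matrix.frobenius_norm_def, Real.sqrt_eq_rpow, frobSq_eq_sum_sq]
  congr 1
  refine Finset.sum_congr rfl fun i _ => Finset.sum_congr rfl fun j _ => ?_
  rw [Real.rpow_two, Real.norm_eq_abs, sq_abs]

/-- Entrywise complexification preserves the Frobenius norm. [folklore] -/
private theorem norm_map_ofReal {k l : ℕ} (M : Matrix (Fin k) (Fin l) ℝ) :
    ‖M.map ((↑) : ℝ → ℂ)‖ = ‖M‖ :=
  Matrix.frobenius_norm_map_eq M _ fun a => Complex.norm_real a

/-- **Assembly (deterministic; the print's "As a consequence" display at the matrix level).**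
For a real symmetric `H` and ANY two real matrices `M_c`, `M_s` (the outputs
`Rᵀ \bar f_cos(CCᵀ) R`, `R'ᵀ \bar f_sinc(C'C'ᵀ) R'` of the two sketches) with
`‖M_c + I − cos H‖_F ≤ ε₁` and `‖M_s + I − sinc H‖_F ≤ ε₂`, the complex matrix
`(M_c + I) + i·H(M_s + I)` is within Frobenius distance `ε₁ + ‖H‖_F·ε₂` of `cos H + i·sin H`
(`= e^{iH}`; Euler).  The print takes `ε₂ = ε/t` with `t = ‖H‖` (operator norm); in the host's
Frobenius currency `t ↦ ‖H‖_F` and `ε₂ = ε/‖H‖_F` gives total error `2ε`.  The vector step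
(`u ≈ Rb`, the output `SQ_φ(b̂)`), the running time and the union bound over the two independent
sketch runs (success probability `≥ 1 − 2δ`) are not typed. [cite: ChiaEtAl2022, §4.5 Problem 4.14
("output `SQ_φ(b̂)` … `‖b̂ − e^{iH}b‖ ≤ ε`", p. 29 L16–19) and proof of Corollary 4.16 ("As a
consequence", p. 29 L72 – p. 30 L10)] -/
theorem euler_assembly_error_le (hH : H.IsHermitian) (Mc Ms : Matrix (Fin n) (Fin n) ℝ)
    {ε₁ ε₂ : ℝ} (h1 : Real.sqrt (frobSq (Mc + 1 - cfc Real.cos H)) ≤ ε₁)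
    (h2 : Real.sqrt (frobSq (Ms + 1 - cfc Real.sinc H)) ≤ ε₂) :
    ‖((Mc + 1).map ((↑) : ℝ → ℂ) + Complex.I • (H * (Ms + 1)).map ((↑) : ℝ → ℂ)) -
        ((cfc Real.cos H).map ((↑) : ℝ → ℂ) + Complex.I • (cfc Real.sin H).map ((↑) : ℝ → ℂ))‖ ≤
      ε₁ + Real.sqrt (frobSq H) * ε₂ := by
  have hs := sin_error_le hH Ms h2
  rw [sqrt_frobSq_eq_norm'] at h1 hs
  have hsplit : ((Mc + 1).map ((↑) : ℝ → ℂ) + Complex.I • (H * (Ms + 1)).map ((↑) : ℝ → ℂ)) -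
      ((cfc Real.cos H).map ((↑) : ℝ → ℂ) + Complex.I • (cfc Real.sin H).map ((↑) : ℝ → ℂ)) =
      (Mc + 1 - cfc Real.cos H).map ((↑) : ℝ → ℂ) +
        Complex.I • (H * (Ms + 1) - cfc Real.sin H).map ((↑) : ℝ → ℂ) := by
    rw [Matrix.map_sub _ (fun a b => Complex.ofReal_sub a b),
      Matrix.map_sub _ (fun a b => Complex.ofReal_sub a b), smul_sub]
    abel
  rw [hsplit]
  calc _ ≤ ‖(Mc + 1 - cfc Real.cos H).map ((↑) : ℝ → ℂ)‖ +
        ‖Complex.I • (H * (Ms + 1) - cfc Real.sin H).map ((↑) : ℝ → ℂ)‖ := norm_add_le _ _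
    _ = ‖Mc + 1 - cfc Real.cos H‖ + ‖H * (Ms + 1) - cfc Real.sin H‖ := by
        rw [norm_smul, Complex.norm_I, one_mul, norm_map_ofReal, norm_map_ofReal]
    _ ≤ ε₁ + Real.sqrt (frobSq H) * ε₂ := add_le_add h1 hs

end ComplexReading

/-- **Display (the printed `t¹⁶`).**  In the print the dominant cost of Corollary 4.16 is the sinc
branch, `r_sinc² c_sinc` (forming `\bar f_sinc(C'C'†)`) with `r_sinc ≍ ‖H‖_F²t⁴/ε²`,
`c_sinc ≍ ‖H‖_F²t⁸/ε²` (`t = ‖H‖`): `(F t⁴ ℓ/ε²)²·(F t⁸ ℓ/ε²) = F³ t¹⁶ ℓ³/ε⁶` (`F = ‖H‖_F²`, `ℓ` the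
log factor) — the time `Õ(t¹⁶‖H‖_F⁶ε⁻⁶log³(1/δ))` of Corollary 4.16 (the base `t` of the displayed
power `16` is the one Bakshi–Tang quote for this corollary).  At the thresholds of `sinc_sketch` run
at accuracy `ε'`, `s = (8/9)φ²F²ℓ/ε'²` and `c = (2/225)φ⁶F⁴ℓ/ε'²`, the same product reads
`s²c = (128/18225)·φ¹⁰F⁸ℓ³/ε'⁶`; with `ε' = ε/‖H‖_F` (so that `sin_error_le` returns `ε`;
`ε'² = ε²/F`) this is `(128/18225)·φ¹⁰F¹¹ℓ³/ε⁶` — the print's `F³t¹⁶` under the host's relaxation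
`t² ↦ φ‖H‖_F²` (`F³(φF)⁸ = φ⁸F¹¹`; the extra `φ²` is the host's `c`-threshold bookkeeping).
Arithmetic identities recording the printed cost model; no algorithm or running time is modelled
here. [cite: ChiaEtAl2022, §4.5 Corollary 4.16 (runtime display, p. 29 L31–33) and its proof
(`r_sinc`, `c_sinc`, p. 29 L66–71)]; [cite: BakshiTang2023, Remark 1.7 ("The only prior work
[CGLLTW22] … obtains a running time `O(t¹⁶‖H‖_F⁶/ε⁶)`", arXiv PDF p. 11)] -/
theorem sinc_threshold_product_display (φ F ℓ ε ε' t : ℝ) (hε : ε ≠ 0) (hε' : ε' ≠ 0) :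
    (F * t ^ 4 * ℓ / ε ^ 2) ^ 2 * (F * t ^ 8 * ℓ / ε ^ 2) = F ^ 3 * t ^ 16 * ℓ ^ 3 / ε ^ 6 ∧
    (8 / 9 * φ ^ 2 * F ^ 2 * ℓ / ε' ^ 2) ^ 2 * (2 / 225 * φ ^ 6 * F ^ 4 * ℓ / ε' ^ 2) =
      128 / 18225 * φ ^ 10 * F ^ 8 * ℓ ^ 3 / ε' ^ 6 := by
  constructor
  · field_simp
  · field_simp
    ring


/-! ### §5 Euler: `e^{iH} = cos H + i sin H` for the complexified symmetric matrix -/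

section Euler

open NormedSpace

/-- Star of a complexified real matrix is the complexified transpose. [folklore] -/
private theorem map_star_eq_star_map (U : Matrix (Fin n) (Fin n) ℝ) :
    (star U).map ((↑) : ℝ → ℂ) = star (U.map ((↑) : ℝ → ℂ)) := by
  ext i j
  simp [Matrix.star_apply, Matrix.map_apply]

/-- **Euler's formula for a real symmetric matrix (spectral theorem).**  For real symmetric `H`
with complexification `H_ℂ := (H_{ij})_{ij} ∈ ℂ^{n×n}`,
`exp(i·H_ℂ) = (cos H)_ℂ + i·(sin H)_ℂ`, where `cos H`, `sin H` are the real continuous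
functional calculi — so `euler_assembly_error_le` bounds the Frobenius distance to the printed
target `e^{iH}` of Problem 4.14.  Proof: diagonalise `H = UΛUᵀ` (`U` real orthogonal),
`cfc f H = U f(Λ) Uᵀ`, `exp(i UΛU*) = U exp(iΛ) U*` and `e^{iλ} = cos λ + i sin λ` entrywise.
[cite: ChiaEtAl2022, §4.5 Problem 4.14 and the identity "`e^{iH} b = cos(H) b + i·sinc(H) H b`"
(p. 29 L16–19, L40–43)] -/
theorem exp_I_smul_map_eq (hH : H.IsHermitian) :
    exp (Complex.I • H.map ((↑) : ℝ → ℂ)) =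
      (cfc Real.cos H).map ((↑) : ℝ → ℂ) + Complex.I • (cfc Real.sin H).map ((↑) : ℝ → ℂ) := by
  classical
  set U : Matrix (Fin n) (Fin n) ℝ := (hH.eigenvectorUnitary : Matrix (Fin n) (Fin n) ℝ) with hU
  set ev : Fin n → ℝ := hH.eigenvalues with hev
  have hUU : U * star U = 1 := Unitary.coe_mul_star_self hH.eigenvectorUnitary
  have hU'U : star U * U = 1 := Unitary.coe_star_mul_self hH.eigenvectorUnitary
  -- the real functional calculus and the spectral theorem as triple products
  have hcfc : ∀ f : ℝ → ℝ, cfc f H = U * Matrix.diagonal (f ∘ ev) * star U := by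
    intro f
    rw [hH.cfc_eq, Matrix.IsHermitian.cfc, Unitary.conjStarAlgAut_apply]
    congr 2
  have hspec : H = U * Matrix.diagonal ev * star U := by
    calc H = _ := hH.spectral_theorem
      _ = U * Matrix.diagonal ev * star U := by rw [Unitary.conjStarAlgAut_apply]; congr 2
  -- complexification as a ring homomorphism
  let φ : Matrix (Fin n) (Fin n) ℝ →+* Matrix (Fin n) (Fin n) ℂ := Complex.ofRealHom.mapMatrix
  have hφ : ∀ M : Matrix (Fin n) (Fin n) ℝ, M.map ((↑) : ℝ → ℂ) = φ M := fun M => rfl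
  have hφdiag : ∀ g : Fin n → ℝ, φ (Matrix.diagonal g) = Matrix.diagonal (fun k => (g k : ℂ)) := by
    intro g
    change (Matrix.diagonal g).map ((↑) : ℝ → ℂ) = _
    rw [Matrix.diagonal_map (Complex.ofReal_zero)]
  set Uc : Matrix (Fin n) (Fin n) ℂ := φ U with hUc
  have hstar : φ (star U) = star Uc := by
    rw [hUc, ← hφ, ← hφ]; exact map_star_eq_star_map U
  have hUc1 : Uc * star Uc = 1 := by rw [← hstar, hUc, ← map_mul, hUU, map_one]
  have hUc2 : star Uc * Uc = 1 := by rw [← hstar, hUc, ← map_mul, hU'U, map_one]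
  have hinv : Uc⁻¹ = star Uc := Matrix.inv_eq_right_inv hUc1
  have hunit : IsUnit Uc := (Matrix.isUnit_iff_isUnit_det _).2
    (Matrix.isUnit_det_of_right_inverse hUc1)
  have htriple : ∀ g : Fin n → ℝ, (U * Matrix.diagonal g * star U).map ((↑) : ℝ → ℂ) =
      Uc * Matrix.diagonal (fun k => (g k : ℂ)) * star Uc := by
    intro g
    rw [hφ, map_mul, map_mul, hφdiag, hstar]
  -- left-hand side
  have hL : exp (Complex.I • H.map ((↑) : ℝ → ℂ)) =
      Uc * Matrix.diagonal (fun k => (Real.cos (ev k) : ℂ) + Complex.I * (Real.sin (ev k) : ℂ)) *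
        star Uc := by
    conv_lhs => rw [hspec, htriple ev]
    rw [← Matrix.smul_mul, ← Matrix.mul_smul, ← hinv, Matrix.exp_conj _ _ hunit,
      ← Matrix.diagonal_smul, Matrix.exp_diagonal]
    congr 2
    congr 1
    funext k
    rw [Pi.exp_def]
    simp only [Pi.smul_apply, smul_eq_mul]
    rw [← Complex.exp_eq_exp_ℂ, mul_comm, Complex.exp_mul_I, ← Complex.ofReal_cos,
      ← Complex.ofReal_sin]
    ring
  -- right-hand side
  have hR : (cfc Real.cos H).map ((↑) : ℝ → ℂ) + Complex.I • (cfc Real.sin H).map ((↑) : ℝ → ℂ) =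
      Uc * Matrix.diagonal (fun k => (Real.cos (ev k) : ℂ) + Complex.I * (Real.sin (ev k) : ℂ)) *
        star Uc := by
    rw [hcfc Real.cos, hcfc Real.sin, htriple, htriple]
    have hdiag : Matrix.diagonal (fun k => (Real.cos (ev k) : ℂ) + Complex.I * (Real.sin (ev k) : ℂ)) =
        Matrix.diagonal (fun k => ((Real.cos ∘ ev) k : ℂ)) +
          Complex.I • Matrix.diagonal (fun k => ((Real.sin ∘ ev) k : ℂ)) := by
      rw [Matrix.smul_eq_diagonal_mul, Matrix.diagonal_mul_diagonal, ← Matrix.diagonal_add]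
      rfl
    rw [hdiag, Matrix.mul_add, Matrix.add_mul, Matrix.mul_smul, Matrix.smul_mul]
  rw [hL, hR]

end Euler

end HamiltonianSimulation

end SampleQuery

end Literature.Computability.QuantumComplexity
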